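import Summits.CriticalPhenomena.PercolationContinuityZ3.Theorems.PercNearOneGluingAdditiveGluingKnLemma3Mixed
import HarnessLib

/-! # Crux `PercNearOneGluing.AdditiveGluing` (stmt-CriticalPhenomena-4576), line `tieline` —
stub `stub_exchangeAvoidMeets_c7`: the two-sided Kozma–Nitzan exchange given `o ∉ C(x)` and
`C(y)` meets `M`

For the bond percolation measure `μ = prodBernoulli w` of a finite weighted graph on `Fin n`,
vertices `x, y, o, b` and a finite vertex set `M`: if `μ(x ↔ b) ≤ μ(y ↔ b)` then
`μ(x ↔ b, x ↮ y, x ↮ o, y ↔ M) ≤ μ(y ↔ b, x ↮ y, x ↮ o, y ↔ M)`, where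
`{y ↔ M} = ⋃_{m ∈ M} {y ↔ m}` (Kozma–Nitzan, arXiv:2401.12397, Lemma 3 (pp. 6–7), parts (i) and
(ii) at once, for a MIXED conditioning event).

## Proof

The conditioning event `Q = {x ↮ y} ∩ {x ↮ o} ∩ {y ↔ M}` is a mixed-monotone function of the pair
of open edge clusters `(C_y, C_x)`: `{y ↔ M}` is increasing in `C_y`, and `{x ↮ y}`, `{x ↮ o}` are
decreasing in `C_x` (all read off the edge clusters via `reachable_iff_exists_mem_openEdgeCluster`).
Hence this is the landed mixed form of Lemma 3, `knLemma3Mixed` (file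
`…AdditiveGluingKnLemma3Mixed.lean`, proved from van den Berg–Häggström–Kahn 2006, Thm. 1.5, twice
on `D = {y ↮ x}`), with `a₁ = x`, `a₂ = y`, slack `d = 0`, after reassociating the intersection
(putting `{x ↮ y}` inside `Q` makes the "remove the common part on `{x ↔ y}`" step of the printed
proof unnecessary).
-/

namespace Summit.CriticalPhenomena.PercolationContinuityZ3.Theorems

open MeasureTheory Set Literature.Probability.LatticeModels Literature.Probability.Percolation

noncomputable section
open Classical

/-- `{x ↮ z}` is decreasing in the open edge cluster of `x`: if `C_x ω' ⊆ C_x ω` and `x ↮ z` in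
`ω`, then `x ↮ z` in `ω'`. [folklore] -/
theorem exchangeAvoidMeets_not_reachable_anti {n : ℕ} {ω ω' : BondConfig (Fin n)} {x z : Fin n}
    (h1 : openEdgeCluster ω' x ⊆ openEdgeCluster ω x) (hno : ¬ (openGraph ω).Reachable x z) :
    ¬ (openGraph ω').Reachable x z := by
  intro hz
  rcases (reachable_iff_exists_mem_openEdgeCluster ω' x z).1 hz with rfl | ⟨e, he, hze⟩
  · exact hno (SimpleGraph.Reachable.refl _)
  · exact hno ((reachable_iff_exists_mem_openEdgeCluster ω x _).2 (Or.inr ⟨e, h1 he, hze⟩))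

/-- `{y ↔ m}` is increasing in the open edge cluster of `y`: if `C_y ω ⊆ C_y ω'` and `y ↔ m` in
`ω`, then `y ↔ m` in `ω'`. [folklore] -/
theorem exchangeAvoidMeets_reachable_mono {n : ℕ} {ω ω' : BondConfig (Fin n)} {y m : Fin n}
    (h2 : openEdgeCluster ω y ⊆ openEdgeCluster ω' y) (hy : (openGraph ω).Reachable y m) :
    (openGraph ω').Reachable y m := by
  rcases (reachable_iff_exists_mem_openEdgeCluster ω y m).1 hy with rfl | ⟨e, he, hme⟩
  · exact SimpleGraph.Reachable.refl _
  · exact (reachable_iff_exists_mem_openEdgeCluster ω' y _).2 (Or.inr ⟨e, h2 he, hme⟩)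

/-- The event `{x ↮ y} ∩ {x ↮ o} ∩ {y ↔ M}` is mixed-monotone in the pair of open edge clusters
`(C_y, C_x)`: increasing in `C_y`, decreasing in `C_x`. [folklore] -/
theorem exchangeAvoidMeets_mixedMonotone {n : ℕ} (x y o : Fin n) (M : Finset (Fin n)) :
    ∀ ω ω' : BondConfig (Fin n),
      ω ∈ ((openConn x y)ᶜ ∩ (openConn x o)ᶜ ∩ ⋃ m ∈ M, openConn y m : Set (BondConfig (Fin n))) →
      openEdgeCluster ω y ⊆ openEdgeCluster ω' y → openEdgeCluster ω' x ⊆ openEdgeCluster ω x →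
      ω' ∈ ((openConn x y)ᶜ ∩ (openConn x o)ᶜ ∩ ⋃ m ∈ M, openConn y m : Set (BondConfig (Fin n)))
    := by
  rintro ω ω' ⟨⟨hxy, hxo⟩, hM⟩ h2 h1
  obtain ⟨m, hmM, hym⟩ := Set.mem_iUnion₂.1 hM
  exact ⟨⟨exchangeAvoidMeets_not_reachable_anti h1 hxy, exchangeAvoidMeets_not_reachable_anti h1 hxo⟩,
    Set.mem_iUnion₂.2 ⟨m, hmM, exchangeAvoidMeets_reachable_mono h2 hym⟩⟩

/-- **Two-sided Kozma–Nitzan exchange given `o ∉ C(x)` and `C(y)` meets `M`** (registered stub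
`stub_exchangeAvoidMeets_c7` of line `tieline`).  If `μ(x ↔ b) ≤ μ(y ↔ b)` for
`μ = prodBernoulli w`, then `μ(x ↔ b, x ↮ y, x ↮ o, y ↔ M) ≤ μ(y ↔ b, x ↮ y, x ↮ o, y ↔ M)`: the
event `{x ↮ y} ∩ {x ↮ o} ∩ {y ↔ M}` is increasing in the cluster of `y` and decreasing in the
cluster of `x`, so the mixed form `knLemma3Mixed` of Lemma 3 (BHK 2006 Thm. 1.5 twice given
`{x ↮ y}`) applies with `a₁ = x`, `a₂ = y`, `d = 0`.
[cite: KozmaNitzan2024, Lemma 3 (pp. 6–7)] [cite: VandenbergHaggstromKahn2005, Thm. 1.5 (p. 7)] -/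
theorem stub_exchangeAvoidMeets_c7 : ∀ (n : ℕ) (w : Sym2 (Fin n) → unitInterval) (x y o b : Fin n)
    (M : Finset (Fin n)),
    (prodBernoulli w).real (openConn x b) ≤ (prodBernoulli w).real (openConn y b) →
    (prodBernoulli w).real (openConn x b ∩ (openConn x y)ᶜ ∩ (openConn x o)ᶜ ∩ ⋃ m ∈ M, openConn y m) ≤
      (prodBernoulli w).real (openConn y b ∩ (openConn x y)ᶜ ∩ (openConn x o)ᶜ ∩ ⋃ m ∈ M, openConn y m)
    := by
  intro n w x y o b M hle
  have key := knLemma3Mixed n w x y b ((openConn x y)ᶜ ∩ (openConn x o)ᶜ ∩ ⋃ m ∈ M, openConn y m) 0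
    (exchangeAvoidMeets_mixedMonotone x y o M) le_rfl (by rw [add_zero]; exact hle)
  rw [add_zero] at key
  simpa only [Set.inter_assoc] using key

end

end Summit.CriticalPhenomena.PercolationContinuityZ3.Theorems
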